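import Literature.NumberTheory.Automorphic.RubinCSSTheoremB
import Literature.NumberTheory.Automorphic.CDTTheorem712TwoLiftsProofs
import HarnessLib

/-!
# Rubin CSS XVI Theorem B — bookkeeping (proofs companion of `RubinCSSTheoremB`)

Domination of `rubinCSS_theoremB` by the catalogued Theorem A (`exists_isNewformOf`, every odd `p`),
by `CDT_theorem_7_2_1` (`p = 3`) and by `CDT_theorem_7_2_2` (`p = 5`), its form in BCDT condition (4), and its two slices that are VERBATIM
the lifting stubs `stub_liftThree` / `stub_liftFive` of the summit crux `FreyModularity` (stmt-ABC-11340,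
`Summits/ABC/ABC/Cruxes/FreyModularity/Lines/Sketch.lean`). All PROVED.
-/

noncomputable section

open scoped MatrixGroups NumberField
open Literature.NumberTheory.GaloisRepresentations
open Literature.NumberTheory.EllipticCurves.ModularForms WeierstrassCurve

open Literature.NumberTheory.Automorphic Literature.NumberTheory.Automorphic.BCDT

namespace Literature.NumberTheory.Automorphic.BCDT

/-- Theorem B is, for EVERY odd `p`, a consequence of the catalogued Theorem A
(`exists_isNewformOf` = "every elliptic curve over `ℚ` is modular", `exists_isNewformOf_iff`):
its conclusion `IsModular W` holds for all elliptic `W / ℚ`, so the fact adds nothing to the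
trust base of Theorem A (BCDT, p. 843: Theorem A; Rubin's Theorem B is one of its inputs).
[cite: BCDTJAMS2001, Theorem A] -/
theorem rubinCSS_theoremB_of_exists_isNewformOf
    (h : Literature.NumberTheory.EllipticCurves.ModularForms.exists_isNewformOf) :
    rubinCSS_theoremB :=
  fun _ _ _ W _ _ _ _ _ _ _ ↦ h W

/-- The `p = 3` case of Theorem B (curves semistable at `3`, i.e. `9 ∤ N_E`) follows from the
catalogued CDT Thm. 7.2.1 (`27 ∤ N_E`), since `9 ∤ N_E ⇒ 27 ∤ N_E`; the hypothesis "`ρ̄_{E,3}`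
modular" is not even needed (Langlands–Tunnell is inside 7.2.1; CDT, p. 553: Thm. 7.2.1 is "the following
weaker version of Theorem 7.1.2", proved in the twist-semistable case "by Theorem 5.4 of [12]" =
Diamond 1996). [cite: ConradDiamondTaylor1999, Thm. 7.2.1 (p. 553)] -/
theorem rubinCSS_theoremB_three_of_CDT_theorem_7_2_1 (h : CDT_theorem_7_2_1)
    (W : WeierstrassCurve ℚ) [W.IsElliptic] [NeZero (W.conductorNorm ℤ)]
    (ρ : ModPGaloisRep ℚ (ZMod 3) 2) (hρ : W.IsTorsionGaloisRep 3 ρ)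
    (hirr : ρ.IsAbsIrreducibleOverSqrt (-3)) (h9 : ¬ 9 ∣ W.conductorNorm ℤ) : IsModular W :=
  h W ρ hρ hirr fun h27 ↦ h9 (dvd_trans ⟨3, rfl⟩ h27)

/-- The `p = 5` case of Theorem B follows from the catalogued CDT Thm. 7.2.2 (which has no
hypothesis at `5`; CDT, p. 553). [cite: ConradDiamondTaylor1999, Thm. 7.2.2 (p. 553)] -/
theorem rubinCSS_theoremB_five_of_CDT_theorem_7_2_2 (h : CDT_theorem_7_2_2)
    (W : WeierstrassCurve ℚ) [W.IsElliptic] [NeZero (W.conductorNorm ℤ)]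
    (ρ : ModPGaloisRep ℚ (ZMod 5) 2) (hρ : W.IsTorsionGaloisRep 5 ρ)
    (hirr : ρ.IsAbsIrreducibleOverSqrt 5) (hmod : ρ.IsModular) : IsModular W :=
  h W ρ hρ hirr hmod

/-- Theorem B in BCDT's condition (4): under its hypotheses `ρ_{E,p}` is modular
(`IsModularGaloisRepTate p`), by the PROVED (2) ⇒ (4) `IsModular.isModularGaloisRepTate`.
[cite: RubinCSS1997, Thm. B (p. 463)] -/
theorem isModularGaloisRepTate_of_rubinCSS_theoremB (h : rubinCSS_theoremB) (p : ℕ) [Fact p.Prime]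
    (hp : p ≠ 2) (W : WeierstrassCurve ℚ) [W.IsElliptic] (ρ : ModPGaloisRep ℚ (ZMod p) 2)
    (hρ : W.IsTorsionGaloisRep p ρ)
    (hirr : ρ.IsAbsIrreducibleOverSqrt ((-1 : ℚ) ^ ((p - 1) / 2) * p))
    (hN : ¬ p ^ 2 ∣ W.conductorNorm ℤ) (hmod : ρ.IsModular) : W.IsModularGaloisRepTate p := by
  haveI : NeZero (W.conductorNorm ℤ) := ⟨(conductorNorm_pos_holds W).ne'⟩
  exact (h p hp W ρ hρ hirr hN hmod).isModularGaloisRepTate p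

/-- **Theorem B at `p = 3` is verbatim the `3`-adic lifting stub `stub_liftThree` of the summit
crux `FreyModularity`** (`ρ̄_{E,3}|_{ℚ(√-3)}` absolutely irreducible, `9 ∤ N_E`, `ρ̄_{E,3}` modular
`⇒ ρ_{E,3}` modular). [cite: RubinCSS1997, Thm. B (p. 463)] -/
theorem liftThree_of_rubinCSS_theoremB (h : rubinCSS_theoremB) :
    ∀ (W : WeierstrassCurve ℚ) [W.IsElliptic] (ρ : ModPGaloisRep ℚ (ZMod 3) 2),
      W.IsTorsionGaloisRep 3 ρ → ρ.IsAbsIrreducibleOverSqrt (-3) → ¬ 9 ∣ W.conductorNorm ℤ →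
      ρ.IsModular → W.IsModularGaloisRepTate 3 := by
  intro W _ ρ hρ hirr h9 hmod
  have e : ((-1 : ℚ) ^ ((3 - 1) / 2) * (3 : ℕ)) = -3 := by norm_num
  exact isModularGaloisRepTate_of_rubinCSS_theoremB h 3 (by norm_num) W ρ hρ (e ▸ hirr)
    (by norm_num; exact h9) hmod

/-- **Theorem B at `p = 5` is verbatim the `5`-adic lifting stub `stub_liftFive` of the summit
crux `FreyModularity`** (`ρ̄_{E,5}|_{ℚ(√5)}` absolutely irreducible, `25 ∤ N_E`, `ρ̄_{E,5}` modular
`⇒ ρ_{E,5}` modular). [cite: RubinCSS1997, Thm. B (p. 463)] -/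
theorem liftFive_of_rubinCSS_theoremB (h : rubinCSS_theoremB) :
    ∀ (W : WeierstrassCurve ℚ) [W.IsElliptic] (ρ : ModPGaloisRep ℚ (ZMod 5) 2),
      W.IsTorsionGaloisRep 5 ρ → ρ.IsAbsIrreducibleOverSqrt 5 → ¬ 25 ∣ W.conductorNorm ℤ →
      ρ.IsModular → W.IsModularGaloisRepTate 5 := by
  intro W _ ρ hρ hirr h25 hmod
  have e : ((-1 : ℚ) ^ ((5 - 1) / 2) * (5 : ℕ)) = 5 := by norm_num
  exact isModularGaloisRepTate_of_rubinCSS_theoremB h 5 (by norm_num) W ρ hρ (e ▸ hirr)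
    (by norm_num; exact h25) hmod

end Literature.NumberTheory.Automorphic.BCDT

end
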